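import Summits.RiemannHypothesis.RiemannHypothesis.Theorems.HandoffDodgerSmallPhi
import Summits.RiemannHypothesis.RiemannHypothesis.Theorems.HandoffDodgerProfileDefs
import HarnessLib

/-!
# HANDOFF — FOURTH SLAB (5): the profile value at `y = 28`, window `α = 12/25` (rh-explicit, W-P(P2) crux 19185, seat dodger-p2 gen0; DODGER-STAGE2-PLAN §2)

RH-FREE. HONEST FRAMING: nothing here bears on the truth of RH; part (5) of the discharge of the hypotheses of
`HandoffDodgerExplicitWindow.dodger_witness_explicit_window` on the fourth slab `7100 ≤ q < 12500` at the constant schedule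
`y = 28`, `α = 12/25`: the profile argument is the CONSTANT `x = (199α/100)²·y² = (2388/2500)²·784 = 715.327…`, so ONE partial sum
suffices — `Φ(x) ≥ Φ(715) ≥ Σ_{n ≤ 12} 715ⁿ/(n!(2n)!) ≥ 1.506·10⁶` (**`dodgerPhi_slabFour_ge`**); the per-sub-slab numeric comparison
`2490·B₂(B₂+1.17)·X < 0.0257·κ₀²·(1.506·10⁶)²` is then a `norm_num` fact in the assembly. gen13's `HandoffDodgerSlabThreePhi` re-constanted.

References: this track (ATTEMPT-16 §1, ATTEMPT-21 §6, ATTEMPT-23 §2/§7; HOME/rh-explicit-dodger-p2/DODGER-STAGE2-PLAN.md §2).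
-/

set_option linter.dupNamespace false

noncomputable section

open Real Finset

namespace Summit.RiemannHypothesis.RiemannHypothesis.Theorems.Handoff

/-- `Σ_{n ≤ 12} 715ⁿ/(n!(2n)!) ≥ 1.506·10⁶`. [this track, DODGER-STAGE2-PLAN §2] -/
theorem profileSum_ge_slabFour :
    (1506000 : ℝ) ≤ ∑ n ∈ range 13, (715 : ℝ) ^ n / ((n.factorial : ℝ) * ((2 * n).factorial : ℝ)) := by
  simp only [sum_range_succ, sum_range_zero, Nat.factorial]
  norm_num

/-- **Part (5) of the fourth-slab discharge: the profile value at `y = 28`, `α = 12/25`.**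
`1.506·10⁶ ≤ Φ((199·(12/25)/100)²·28²)` (`Φ = dodgerPhi`). [this track, DODGER-STAGE2-PLAN §2] -/
theorem dodgerPhi_slabFour_ge : (1506000 : ℝ) ≤ dodgerPhi ((199 * (12 / 25 : ℝ) / 100) ^ 2 * 28 ^ 2) := by
  have hS := profileSum_le_of_hasSum (by norm_num : (0 : ℝ) ≤ 715) (summable_dodgerPhiTerm 715).hasSum 13
  have h1 : (1506000 : ℝ) ≤ dodgerPhi 715 := profileSum_ge_slabFour.trans hS
  have h2 : dodgerPhi 715 ≤ dodgerPhi ((199 * (12 / 25 : ℝ) / 100) ^ 2 * 28 ^ 2) :=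
    dodgerPhi_le_dodgerPhi (by norm_num) (by norm_num)
  exact h1.trans h2

end Summit.RiemannHypothesis.RiemannHypothesis.Theorems.Handoff

end
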